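import Literature.AlgebraicGeometry.Frobenioids.Thm42DivIdentityPreserved
import Literature.AlgebraicGeometry.Frobenioids.Thm42PrimaryStepsReflect
import Literature.AlgebraicGeometry.Frobenioids.DivisorMonoidCategoryTheoreticityThm42FSM
import Literature.AlgebraicGeometry.Frobenioids.EquivalenceFrobeniusQuasiIsotropic
import Literature.AlgebraicGeometry.Frobenioids.DivFrobeniusTrivialTransport
import HarnessLib

/-!
# [FrdI] Theorem 4.2 (i)(ii)(iii) — ASSEMBLY of the S5 sub-DAG (row `FrdI:Thm4.2/T42-L00`)

Mochizuki, *The geometry of Frobenioids I: the general theory*, Kyushu J. Math. **62** (2008)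
293–400, §4, Theorem 4.2, statement p. 77 l. 23 – p. 78, proof p. 78 l. 28 – p. 81 l. 62
[cite: MochizukiFrdI2008, Thm. 4.2 p.77] (render `paper:url-bbf705efa10f`).

PROOF-ONLY assembly file (sub-DAG `plan/L1/SUBDAG-FrdI-Thm42-Thm49.md`, row `T42-L00` `Assembly42`:
"(i) = L01+L02+L03+L07+L11; (ii) = L08+L09+L10; (iii) = L12+L13 → the typed `Thm42i/Thm42ii/Thm42iii`
closing types"; L1-lead ruling R95 (3), seat abc-iut-w5-d162). Nothing is re-proved: the rows are
IMPORTED BY NAME —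
* L04–L07 ⇒ `FrdI.T42.Setting.isPrimaryPreStep_map` / `isPrimaryPreStep_inverse_map` ("`Ψ`, `Ψ⁻¹`
  preserve primary steps", `Thm42PrimaryStepsPropagation.lean` / `Thm42PrimaryStepsReflect.lean`, seat abc-iut-w4-d099);
* L11 ⇒ `FrdI.T42.isDivIdentity_map` ("`Ψ` preserves Div-identity endomorphisms",
  `Thm42DivIdentityPreserved.lean`, seat abc-iut-w4-d068; L11a `DivIdentityPrimeRays`, L09/L10
  `PrimesEquivBaseIso`/`Thm42SubProofsIII`/`Thm42SubProofsL10`);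
* L02 (b)(c) formal part ⇒ `PreFrobenioid.isDivFrobeniusTrivial_map` /
  `isUniversallyDivFrobeniusTrivial_map` (`DivFrobeniusTrivialTransport.lean`, seat abc-iut-L1-t14; cf. also
  `Thm42SubProofsL02.lean`, seat abc-iut-w4-d090: the three clauses GIVEN row L11, and
  `FrdI.T42.Setting.isGroupLikeObj_map`);
* L08/L12 ⇒ `PreFrobenioidData.thm42ii_of_perfectType` / `thm42iii_of`
  (`DivisorMonoidCategoryTheoreticityThm42.lean`, seat abc-iut-L1-t14; L13 = abc-iut-L1-d10's monoid kernel);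
* Thm. 3.4 (ii)(iii) over bases of FSM-type (the cell's repaired route, finding PR-1) ⇒
  `FrdI.isPreStep_map_of_isOfFSMType`, `FrdI.degFr_map`, `FrdI.isFrobeniusType_map_quasiIsotropic`,
  `FrdI.isPullbackMorphism_map_quasiIsotropic` (seat abc-iut-L1-t13), `PreFrobenioidData.isStep_map_of_isOfFSMType`.

WHAT THIS FILE ADDS (plumbing only): (1) the setting `FrdI.T42.Setting` of the sub-DAG is symmetric under
`Ψ ↦ Ψ⁻¹` (`Setting.symm`), and the two Thm. 4.2 (i) hypotheses of the row-L11 closer ("`Ψ`, `Ψ⁻¹`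
preserve primary pre-steps") are DISCHARGED by row L07 (`Setting.isDivIdentity_map`); (2) hence all
four clauses of Thm. 4.2 (i) in the setting, given only that `Φ₂` is non-dilating (`thm42i_of_setting`;
non-dilation is clause (e) of "standard type", Def. 3.1 (i)); (3) the typed statements
`PreFrobenioidData.Thm42i/Thm42ii/Thm42iii` (seat abc-iut-L1-t3) for `S_i = ofFunctor Φ_i F_i`, from the
setting ALONE (`thm42i_of_perfectSetting`, `thm42ii_of_perfectSetting`, `thm42iii_of_perfectSetting` — the
Thm. 4.2 (i) hypotheses of abc-iut-L1-t14's conditional closers discharged; isotropy and non-dilation read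
off `Thm42Setting`); (4) over bases of FSM-type the setting itself is DERIVED from `Thm42Setting` +
"`C_i` Frobenioids of perfect type with `Φ_i` perf-factorial" (`setting_of_isOfFSMType`), whence the
closers `thm42i/ii/iii_of_perfectType_of_isOfFSMType` carrying NO Thm. 3.4 / Thm. 4.2 hypothesis.

HONEST RESIDUE (not closed here, recorded for the sub-DAG): (a) the printed generality "standard type"
instead of "perfect type" = row L03 `PerfectWLOG` ("passing to the perfections", p. 78 ll. 40–46:
transport PROVED by abc-iut-w4-d068, `Thm42PerfectReduction`/`Thm42PerfectionReduction`; the input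
"`C^pf` is a Frobenioid of perfect + isotropic type with `Φ^pf` perf-factorial", Prop. 3.2 (iii) /
Prop. 5.5 (iii), is sub-DAG S7 row P55-L06, OPEN), and (b) bases of FSMFF∖FSM type = the cell's standing
Thm. 3.4 residual R2 (GAP-LEDGER). Same universes on both sides, as in `FrdI.Thm42i`. No new definitions;
nothing of the paper is asserted beyond what is proved.
-/

namespace Literature.AlgebraicGeometry.Frobenioids

open CategoryTheory Opposite

universe w v v' u u'

/-! ## 1. The setting is symmetric; consequences of rows L07 and L11 with their hypotheses discharged -/

namespace FrdI.T42

variable {D₁ : Type u} [Category.{v} D₁] {Φ₁ : D₁ᵒᵖ ⥤ CommMonCat.{w}} {C₁ : Type u'} [Category.{v'} C₁]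
  {D₂ : Type u} [Category.{v} D₂] {Φ₂ : D₂ᵒᵖ ⥤ CommMonCat.{w}} {C₂ : Type u'} [Category.{v'} C₂]
  {F₁ : C₁ ⥤ ElemFrobenioid Φ₁} {F₂ : C₂ ⥤ ElemFrobenioid Φ₂} {Ψ : C₁ ≌ C₂}

/-- The setting of the proof of Thm. 4.2 is symmetric under `Ψ ↦ Ψ⁻¹` (every field is recorded for `Ψ`
and for its quasi-inverse; Frobenius degrees of `Ψ⁻¹(φ)` through `Ψ Ψ⁻¹ φ ≅ φ`).
[cite: MochizukiFrdI2008, Thm. 4.2 p.78] -/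
theorem Setting.symm (S : Setting F₁ F₂ Ψ) : Setting F₂ F₁ Ψ.symm where
  isFrobenioid₁ := S.isFrobenioid₂
  isFrobenioid₂ := S.isFrobenioid₁
  perfect₁ := S.perfect₂
  perfect₂ := S.perfect₁
  isotropic₁ := S.isotropic₂
  isotropic₂ := S.isotropic₁
  perfFactorial₁ := S.perfFactorial₂
  perfFactorial₂ := S.perfFactorial₁
  preStep_map := fun _ _ φ hφ => S.preStep_inv φ hφ
  preStep_inv := fun _ _ φ hφ => S.preStep_map φ hφ
  step_map := fun _ _ φ hφ => S.step_inv φ hφ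
  step_inv := fun _ _ φ hφ => S.step_map φ hφ
  frobeniusType_map := fun _ _ φ hφ => S.frobeniusType_inv φ hφ
  frobeniusType_inv := fun _ _ φ hφ => S.frobeniusType_map φ hφ
  degFr_map := fun X Y φ => by
    have h := S.degFr_map (Ψ.inverse.map φ)
    let iX : Ψ.functor.obj (Ψ.inverse.obj X) ≅ X := Ψ.counitIso.app X
    let iY : Ψ.functor.obj (Ψ.inverse.obj Y) ≅ Y := Ψ.counitIso.app Y
    have e1 : Ψ.functor.map (Ψ.inverse.map φ) = iX.hom ≫ φ ≫ iY.inv := Equivalence.fun_inv_map Ψ X Y φ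
    have e2 : PreFrobenioid.degFr F₂ (iX.hom ≫ φ ≫ iY.inv) = PreFrobenioid.degFr F₂ φ :=
      (PreFrobenioid.degFr_iso_comp (F := F₂) iX.hom (φ ≫ iY.inv)).trans
        (PreFrobenioid.degFr_comp_iso (F := F₂) φ iY.inv)
    exact ((congrArg (PreFrobenioid.degFr F₂) e1).symm.trans h).symm.trans e2
  pullback_map := fun _ _ φ hφ => S.pullback_inv φ hφ
  pullback_inv := fun _ _ φ hφ => S.pullback_map φ hφ

/-- **Row L11 with its Thm. 4.2 (i) hypotheses discharged**: in the setting, with `Φ₂` non-dilating, `Ψ`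
preserves Div-identity endomorphisms (abc-iut-w4-d068's `isDivIdentity_map`, fed by row L07 for `Ψ` and
for `Ψ⁻¹`). [cite: MochizukiFrdI2008, Thm. 4.2 (i) p.81] -/
theorem Setting.isDivIdentity_map (S : Setting F₁ F₂ Ψ) (hnd₂ : Literature.AlgebraicGeometry.Frobenioids.IsNonDilatingOn Φ₂) {A : C₁} (α : A ⟶ A)
    (hα : PreFrobenioid.IsDivIdentity F₁ α) : PreFrobenioid.IsDivIdentity F₂ (Ψ.functor.map α) :=
  FrdI.T42.isDivIdentity_map S hnd₂ (fun _ _ _ hφ => S.isPrimaryPreStep_map hφ)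
    (fun _ _ _ hφ => S.isPrimaryPreStep_inverse_map hφ) α hα

/-- **Row L02 (b) with its hypothesis discharged**: in the setting, with `Φ₂` non-dilating, `Ψ` preserves
Div-Frobenius-trivial objects (abc-iut-L1-t14's formal transport + `Setting.isDivIdentity_map`).
[cite: MochizukiFrdI2008, Thm. 4.2 (i) p.78] -/
theorem Setting.isDivFrobeniusTrivial_map (S : Setting F₁ F₂ Ψ) (hnd₂ : Literature.AlgebraicGeometry.Frobenioids.IsNonDilatingOn Φ₂) {A : C₁}
    (hA : PreFrobenioid.IsDivFrobeniusTrivial F₁ A) :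
    PreFrobenioid.IsDivFrobeniusTrivial F₂ (Ψ.functor.obj A) :=
  PreFrobenioid.isDivFrobeniusTrivial_map Ψ S.frobeniusType_map S.degFr_map
    (fun α hα => S.isDivIdentity_map hnd₂ α hα) hA

/-- **Row L02 (c) with its hypothesis discharged**: in the setting, with `Φ₂` non-dilating, `Ψ` preserves
universally Div-Frobenius-trivial objects (pull-backs preserved by `Ψ⁻¹`, Thm. 3.4 (iii)).
[cite: MochizukiFrdI2008, Thm. 4.2 (i) p.78] -/
theorem Setting.isUniversallyDivFrobeniusTrivial_map (S : Setting F₁ F₂ Ψ) (hnd₂ : Literature.AlgebraicGeometry.Frobenioids.IsNonDilatingOn Φ₂)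
    {A : C₁} (hA : PreFrobenioid.IsUniversallyDivFrobeniusTrivial F₁ A) :
    PreFrobenioid.IsUniversallyDivFrobeniusTrivial F₂ (Ψ.functor.obj A) :=
  PreFrobenioid.isUniversallyDivFrobeniusTrivial_map Ψ S.isFrobenioid₂.isPreFrobenioid S.frobeniusType_map
    S.degFr_map S.pullback_inv (fun _ _ _ α hα => S.isDivIdentity_map hnd₂ α hα) hA

/-- **Theorem 4.2 (i) in the setting** (perfect and isotropic type, `Φ_i` perf-factorial, Thm. 3.4 (ii)(iii)
for `Ψ` and `Ψ⁻¹`), given only that `Φ₂` is non-dilating: `Ψ` preserves primary steps, Div-identity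
endomorphisms, Div-Frobenius-trivial objects and universally Div-Frobenius-trivial objects (rows L07, L11,
L02). [cite: MochizukiFrdI2008, Thm. 4.2 (i) p.77] -/
theorem thm42i_of_setting (S : Setting F₁ F₂ Ψ) (hnd₂ : Literature.AlgebraicGeometry.Frobenioids.IsNonDilatingOn Φ₂) :
    (∀ ⦃X Y : C₁⦄ (φ : X ⟶ Y), PreFrobenioid.IsStep F₁ φ ∧ PreFrobenioid.IsPrimaryPreStep F₁ φ →
        PreFrobenioid.IsStep F₂ (Ψ.functor.map φ) ∧ PreFrobenioid.IsPrimaryPreStep F₂ (Ψ.functor.map φ)) ∧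
      (∀ (A : C₁) (α : A ⟶ A), PreFrobenioid.IsDivIdentity F₁ α →
        PreFrobenioid.IsDivIdentity F₂ (Ψ.functor.map α)) ∧
      (∀ ⦃A : C₁⦄, PreFrobenioid.IsDivFrobeniusTrivial F₁ A →
        PreFrobenioid.IsDivFrobeniusTrivial F₂ (Ψ.functor.obj A)) ∧
      ∀ ⦃A : C₁⦄, PreFrobenioid.IsUniversallyDivFrobeniusTrivial F₁ A →
        PreFrobenioid.IsUniversallyDivFrobeniusTrivial F₂ (Ψ.functor.obj A) :=
  ⟨fun _ _ φ hφ => ⟨S.step_map φ hφ.1, S.isPrimaryPreStep_map hφ.2⟩,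
    fun _ α hα => S.isDivIdentity_map hnd₂ α hα,
    fun _ hA => S.isDivFrobeniusTrivial_map hnd₂ hA,
    fun _ hA => S.isUniversallyDivFrobeniusTrivial_map hnd₂ hA⟩

/-- **Row L02 `PreservesDivFrobTrivial`, its three clauses in the setting given `Φ₂` non-dilating** (the
typed slot carries no non-dilation binder and over general bases its clause (a) is the Thm. 3.4 residual;
here (a) ⊆ L11, (b)(c) as above). [cite: MochizukiFrdI2008, Thm. 4.2 (i) p.78] -/
theorem preservesDivFrobTrivial_of_nonDilating (S : Setting F₁ F₂ Ψ) (hnd₂ : Literature.AlgebraicGeometry.Frobenioids.IsNonDilatingOn Φ₂) :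
    (∀ (A : C₁), ¬ PreFrobenioid.IsGroupLikeObj F₁ A → ∀ α : A ⟶ A, PreFrobenioid.IsDivIdentity F₁ α →
        PreFrobenioid.IsPrimeFrobenius F₁ α → PreFrobenioid.IsDivIdentity F₂ (Ψ.functor.map α)) ∧
    (∀ (A : C₁), ¬ PreFrobenioid.IsGroupLikeObj F₁ A → PreFrobenioid.IsDivFrobeniusTrivial F₁ A →
        PreFrobenioid.IsDivFrobeniusTrivial F₂ (Ψ.functor.obj A)) ∧
    ∀ (A : C₁), ¬ PreFrobenioid.IsGroupLikeObj F₁ A → PreFrobenioid.IsUniversallyDivFrobeniusTrivial F₁ A →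
        PreFrobenioid.IsUniversallyDivFrobeniusTrivial F₂ (Ψ.functor.obj A) :=
  ⟨fun _ _ α hα _ => S.isDivIdentity_map hnd₂ α hα, fun _ _ hA => S.isDivFrobeniusTrivial_map hnd₂ hA,
    fun _ _ hA => S.isUniversallyDivFrobeniusTrivial_map hnd₂ hA⟩

end FrdI.T42

/-! ## 2. The typed statements `Thm42i`, `Thm42ii`, `Thm42iii` from the setting alone -/

namespace PreFrobenioidData

variable {D : Type u} [Category.{v} D] {Φ : Dᵒᵖ ⥤ CommMonCat.{w}} {C : Type u'} [Category.{v'} C]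
  {F : C ⥤ ElemFrobenioid Φ}
  {D₂ : Type u} [Category.{v} D₂] {Φ₂ : D₂ᵒᵖ ⥤ CommMonCat.{w}} {C₂ : Type u'} [Category.{v'} C₂]
  {F₂ : C₂ ⥤ ElemFrobenioid Φ₂} (Ψ : C ≌ C₂)

/-- Universally Div-Frobenius-trivial object, through the adapter. [cite: MochizukiFrdI2008, Def. 1.2 (iv) p.22] -/
theorem ofFunctor_isUniversallyDivFrobeniusTrivial (F : C ⥤ ElemFrobenioid Φ) (A : C) :
    (ofFunctor Φ F).IsUniversallyDivFrobeniusTrivial A ↔ PreFrobenioid.IsUniversallyDivFrobeniusTrivial F A :=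
  forall_congr' fun A' => forall_congr' fun φ => by
    rw [ofFunctor_isPullbackMorphism, ofFunctor_isDivFrobeniusTrivial]

/-- **Theorem 4.2 (i) AS TYPED (`Thm42i`), from the setting**: for `C_i → F_{Φ_i}` in the setting of the
proof (perfect type, `Φ_i` perf-factorial, Thm. 3.4 (ii)(iii) for `Ψ`, `Ψ⁻¹`), the typed statement holds —
its own antecedent `Thm42Setting` supplies "standard type", hence `Φ₂` non-dilating (Def. 3.1 (i)(e)).
[cite: MochizukiFrdI2008, Thm. 4.2 (i) p.77] -/
theorem thm42i_of_perfectSetting (S : FrdI.T42.Setting F F₂ Ψ) : (ofFunctor Φ F).Thm42i (ofFunctor Φ₂ F₂) Ψ := by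
  intro hT
  have hnd₂ : Literature.AlgebraicGeometry.Frobenioids.IsNonDilatingOn Φ₂ := FrdI.isNonDilatingOn_of_ofFunctor hT.standard.2.nonDilating
  obtain ⟨h₁, h₂, h₃, h₄⟩ := FrdI.T42.thm42i_of_setting S hnd₂
  refine ⟨fun A B φ hφ => ?_, fun A α hα => ?_, fun A hA => ?_, fun A hA => ?_⟩
  · exact h₁ φ hφ
  · rw [ofFunctor_isDivIdentity] at hα ⊢
    exact h₂ A α hα
  · rw [ofFunctor_isDivFrobeniusTrivial] at hA ⊢
    exact h₃ hA
  · rw [ofFunctor_isUniversallyDivFrobeniusTrivial] at hA ⊢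
    exact h₄ hA

/-- **Theorem 4.2 (ii) AS TYPED (`Thm42ii`), from the setting** — abc-iut-L1-t14's `thm42ii_of_perfectType`
with its Thm. 4.2 (i) hypotheses ("`Ψ`, `Ψ⁻¹` preserve primary pre-steps") DISCHARGED by row L07 for `Ψ`
and `Ψ⁻¹`. [cite: MochizukiFrdI2008, Thm. 4.2 (ii) p.77] -/
theorem thm42ii_of_perfectSetting (S : FrdI.T42.Setting F F₂ Ψ) :
    (ofFunctor Φ F).Thm42ii (ofFunctor Φ₂ F₂) Ψ :=
  thm42ii_of_perfectType Ψ S.isFrobenioid₁ S.isFrobenioid₂ S.perfect₁ S.perfect₂ S.perfFactorial₁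
    S.perfFactorial₂ S.step_map S.step_inv S.preStep_map S.preStep_inv
    (fun _ _ _ hφ => S.isPrimaryPreStep_map hφ) (fun _ _ _ hφ => S.isPrimaryPreStep_inverse_map hφ)

/-- **Theorem 4.2 (iii) AS TYPED (`Thm42iii e`), from the setting**, for ANY family `e` satisfying the two
clauses of (ii) — abc-iut-L1-t14's `thm42iii_of` with its Thm. 4.2 (i) hypothesis ("`Ψ` preserves
Div-identity endomorphisms") DISCHARGED by row L11 (non-dilation read off `Thm42Setting`).
[cite: MochizukiFrdI2008, Thm. 4.2 (iii) p.78] -/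
theorem thm42iii_of_perfectSetting (S : FrdI.T42.Setting F F₂ Ψ)
    (e : ∀ A : C, Primes (Φ.obj (op (PreFrobenioid.baseObj F A))) ≃
      Primes (Φ₂.obj (op (PreFrobenioid.baseObj F₂ (Ψ.functor.obj A)))))
    (he : ∀ (A : C) (𝔭 : Primes (Φ.obj (op (PreFrobenioid.baseObj F A)))),
      (∀ ⦃B : C⦄ (φ : A ⟶ B), PreFrobenioid.IsCoAngularPreStep F φ →
          (PreFrobenioid.Div F φ ∈ 𝔭.submonoid ↔
            PreFrobenioid.Div F₂ (Ψ.functor.map φ) ∈ (e A 𝔭).submonoid)) ∧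
        ∀ ⦃B : C⦄ (ψ : B ⟶ A), PreFrobenioid.IsCoAngularPreStep F ψ →
          ((∃ y ∈ 𝔭.submonoid, Frobenioids.pull Φ (PreFrobenioid.Base F ψ) y = PreFrobenioid.Div F ψ) ↔
            ∃ y ∈ (e A 𝔭).submonoid, Frobenioids.pull Φ₂ (PreFrobenioid.Base F₂ (Ψ.functor.map ψ)) y =
              PreFrobenioid.Div F₂ (Ψ.functor.map ψ))) :
    (ofFunctor Φ F).Thm42iii (ofFunctor Φ₂ F₂) Ψ e := by
  intro hT
  have hnd₂ : Literature.AlgebraicGeometry.Frobenioids.IsNonDilatingOn Φ₂ := FrdI.isNonDilatingOn_of_ofFunctor hT.standard.2.nonDilating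
  exact thm42iii_of Ψ S.isFrobenioid₁ S.isFrobenioid₂ S.perfFactorial₁ S.perfFactorial₂ S.preStep_map
    S.preStep_inv S.frobeniusType_map S.degFr_map (fun A α hα => S.isDivIdentity_map hnd₂ α hα) e he hT

/-! ## 3. Bases of FSM-type: the setting DERIVED from `Thm42Setting`, and the closers -/

/-- **The setting of Thm. 4.2 over bases of FSM-type**: for Frobenioids `C_i → F_{Φ_i}` of PERFECT type with
`Φ_i` perf-factorial over bases `D_i` of FSM-type, the hypotheses `Thm42Setting` of the typed statement
(standard + isotropic type, not of group-like type) supply every field of `FrdI.T42.Setting` — Thm. 3.4 (ii)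
(pre-steps, steps) and (iii) (Frobenius type, Frobenius degrees, pull-backs) for `Ψ` and `Ψ⁻¹` being the
cell's kernel theorems over FSM-type bases (seat abc-iut-L1-t13; standard type ⊇ quasi-isotropic (a) +
non-dilating (e), and "not of group-like type" = a non-group-like object on each side).
[cite: MochizukiFrdI2008, Thm. 3.4 (ii)(iii) p.62] -/
theorem setting_of_isOfFSMType (hF : PreFrobenioid.IsFrobenioid F) (hF₂ : PreFrobenioid.IsFrobenioid F₂)
    (hperf : PreFrobenioid.IsOfPerfectType F) (hperf₂ : PreFrobenioid.IsOfPerfectType F₂)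
    (hpf : Objectwise (fun M _ => IsPerfFactorial M) Φ) (hpf₂ : Objectwise (fun M _ => IsPerfFactorial M) Φ₂)
    (hD : IsOfFSMType D) (hD₂ : IsOfFSMType D₂) (hT : Thm42Setting (ofFunctor Φ F) (ofFunctor Φ₂ F₂)) :
    FrdI.T42.Setting F F₂ Ψ := by
  have histr : PreFrobenioid.IsOfIsotropicType F := (ofFunctor_isOfIsotropicType F).mp hT.isotropic.1
  have histr₂ : PreFrobenioid.IsOfIsotropicType F₂ := (ofFunctor_isOfIsotropicType F₂).mp hT.isotropic.2
  have hq := hT.standard.1.quasiIsotropic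
  have hq₂ := hT.standard.2.quasiIsotropic
  have hnd : Literature.AlgebraicGeometry.Frobenioids.IsNonDilatingOn Φ := FrdI.isNonDilatingOn_of_ofFunctor hT.standard.1.nonDilating
  have hnd₂ : Literature.AlgebraicGeometry.Frobenioids.IsNonDilatingOn Φ₂ := FrdI.isNonDilatingOn_of_ofFunctor hT.standard.2.nonDilating
  obtain ⟨N₁, hN₁⟩ : ∃ A : C, ¬ PreFrobenioid.IsGroupLikeObj F A := by
    have h := hT.notGroupLike.1
    rw [isOfGroupLikeType_iff] at h
    simpa only [ofFunctor_isGroupLikeObj, not_forall] using h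
  obtain ⟨N₂, hN₂⟩ : ∃ A : C₂, ¬ PreFrobenioid.IsGroupLikeObj F₂ A := by
    have h := hT.notGroupLike.2
    rw [isOfGroupLikeType_iff] at h
    simpa only [ofFunctor_isGroupLikeObj, not_forall] using h
  exact
    { isFrobenioid₁ := hF
      isFrobenioid₂ := hF₂
      perfect₁ := hperf
      perfect₂ := hperf₂
      isotropic₁ := histr
      isotropic₂ := histr₂
      perfFactorial₁ := hpf
      perfFactorial₂ := hpf₂
      preStep_map := fun _ _ _ hφ => FrdI.isPreStep_map_of_isOfFSMType hF hF₂ histr histr₂ hD₂ Ψ hφ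
      preStep_inv := fun _ _ _ hφ => FrdI.isPreStep_map_of_isOfFSMType hF₂ hF histr₂ histr hD Ψ.symm hφ
      step_map := fun _ _ _ hφ => isStep_map_of_isOfFSMType Ψ hF hF₂ histr histr₂ hD₂ hφ
      step_inv := fun _ _ _ hφ => isStep_map_of_isOfFSMType Ψ.symm hF₂ hF histr₂ histr hD hφ
      frobeniusType_map := fun _ _ _ hφ =>
        FrdI.isFrobeniusType_map_quasiIsotropic hF hF₂ hq hq₂ hD hD₂ hnd hnd₂ Ψ hN₁ hN₂ hφ
      frobeniusType_inv := fun _ _ _ hφ =>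
        FrdI.isFrobeniusType_map_quasiIsotropic hF₂ hF hq₂ hq hD₂ hD hnd₂ hnd Ψ.symm hN₂ hN₁ hφ
      degFr_map := fun _ _ φ => FrdI.degFr_map hF hF₂ hq hq₂ hD hD₂ hnd hnd₂ Ψ hN₁ hN₂ φ
      pullback_map := fun _ _ _ hφ =>
        FrdI.isPullbackMorphism_map_quasiIsotropic hF hF₂ hq hq₂ hD hD₂ hnd hnd₂ Ψ hN₁ hN₂ hφ
      pullback_inv := fun _ _ _ hφ =>
        FrdI.isPullbackMorphism_map_quasiIsotropic hF₂ hF hq₂ hq hD₂ hD hnd₂ hnd Ψ.symm hN₂ hN₁ hφ }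

/-- **Theorem 4.2 (i) AS TYPED over bases of FSM-type, perfect-type case — NO Thm. 3.4 / Thm. 4.2 hypothesis
left**: for Frobenioids of perfect type with `Φ_i` perf-factorial over FSM-type bases, `Thm42i` holds.
[cite: MochizukiFrdI2008, Thm. 4.2 (i) p.77] -/
theorem thm42i_of_perfectType_of_isOfFSMType (hF : PreFrobenioid.IsFrobenioid F)
    (hF₂ : PreFrobenioid.IsFrobenioid F₂) (hperf : PreFrobenioid.IsOfPerfectType F)
    (hperf₂ : PreFrobenioid.IsOfPerfectType F₂) (hpf : Objectwise (fun M _ => IsPerfFactorial M) Φ)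
    (hpf₂ : Objectwise (fun M _ => IsPerfFactorial M) Φ₂) (hD : IsOfFSMType D) (hD₂ : IsOfFSMType D₂) :
    (ofFunctor Φ F).Thm42i (ofFunctor Φ₂ F₂) Ψ := fun hT =>
  thm42i_of_perfectSetting Ψ (setting_of_isOfFSMType Ψ hF hF₂ hperf hperf₂ hpf hpf₂ hD hD₂ hT) hT

/-- **Theorem 4.2 (ii) AS TYPED over bases of FSM-type, perfect-type case — NO Thm. 3.4 / Thm. 4.2 hypothesis
left** (supersedes the conditional `thm42ii_of_perfectType_of_isOfFSMType`, whose remaining hypothesis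
"`Ψ`, `Ψ⁻¹` preserve primary pre-steps" is row L07). [cite: MochizukiFrdI2008, Thm. 4.2 (ii) p.77] -/
theorem thm42ii_of_perfectType_of_isOfFSMType' (hF : PreFrobenioid.IsFrobenioid F)
    (hF₂ : PreFrobenioid.IsFrobenioid F₂) (hperf : PreFrobenioid.IsOfPerfectType F)
    (hperf₂ : PreFrobenioid.IsOfPerfectType F₂) (hpf : Objectwise (fun M _ => IsPerfFactorial M) Φ)
    (hpf₂ : Objectwise (fun M _ => IsPerfFactorial M) Φ₂) (hD : IsOfFSMType D) (hD₂ : IsOfFSMType D₂) :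
    (ofFunctor Φ F).Thm42ii (ofFunctor Φ₂ F₂) Ψ := fun hT =>
  thm42ii_of_perfectSetting Ψ (setting_of_isOfFSMType Ψ hF hF₂ hperf hperf₂ hpf hpf₂ hD hD₂ hT) hT

/-- **Theorem 4.2 (iii) AS TYPED over bases of FSM-type, perfect-type case**, for ANY family `e` satisfying
the two clauses of (ii) (no Thm. 3.4 / Thm. 4.2 (i) hypothesis left; supersedes the conditional
`thm42iii_of_isOfFSMType`). [cite: MochizukiFrdI2008, Thm. 4.2 (iii) p.78] -/
theorem thm42iii_of_perfectType_of_isOfFSMType' (hF : PreFrobenioid.IsFrobenioid F)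
    (hF₂ : PreFrobenioid.IsFrobenioid F₂) (hperf : PreFrobenioid.IsOfPerfectType F)
    (hperf₂ : PreFrobenioid.IsOfPerfectType F₂) (hpf : Objectwise (fun M _ => IsPerfFactorial M) Φ)
    (hpf₂ : Objectwise (fun M _ => IsPerfFactorial M) Φ₂) (hD : IsOfFSMType D) (hD₂ : IsOfFSMType D₂)
    (e : ∀ A : C, Primes (Φ.obj (op (PreFrobenioid.baseObj F A))) ≃
      Primes (Φ₂.obj (op (PreFrobenioid.baseObj F₂ (Ψ.functor.obj A)))))
    (he : ∀ (A : C) (𝔭 : Primes (Φ.obj (op (PreFrobenioid.baseObj F A)))),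
      (∀ ⦃B : C⦄ (φ : A ⟶ B), PreFrobenioid.IsCoAngularPreStep F φ →
          (PreFrobenioid.Div F φ ∈ 𝔭.submonoid ↔
            PreFrobenioid.Div F₂ (Ψ.functor.map φ) ∈ (e A 𝔭).submonoid)) ∧
        ∀ ⦃B : C⦄ (ψ : B ⟶ A), PreFrobenioid.IsCoAngularPreStep F ψ →
          ((∃ y ∈ 𝔭.submonoid, Frobenioids.pull Φ (PreFrobenioid.Base F ψ) y = PreFrobenioid.Div F ψ) ↔
            ∃ y ∈ (e A 𝔭).submonoid, Frobenioids.pull Φ₂ (PreFrobenioid.Base F₂ (Ψ.functor.map ψ)) y =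
              PreFrobenioid.Div F₂ (Ψ.functor.map ψ))) :
    (ofFunctor Φ F).Thm42iii (ofFunctor Φ₂ F₂) Ψ e := fun hT =>
  thm42iii_of_perfectSetting Ψ (setting_of_isOfFSMType Ψ hF hF₂ hperf hperf₂ hpf hpf₂ hD hD₂ hT) e he hT

/-- **Theorem 4.2 (ii) and (iii) TOGETHER over bases of FSM-type, perfect-type case**: the unique family
`Ψ^Prime` of (ii) exists and, for IT, the right-hand and left-hand monoid isomorphisms of (iii) exist at
every Div-Frobenius-trivial object — no family `e` is assumed. [cite: MochizukiFrdI2008, Thm. 4.2 (ii)(iii) p.78] -/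
theorem thm42ii_iii_of_perfectType_of_isOfFSMType (hF : PreFrobenioid.IsFrobenioid F)
    (hF₂ : PreFrobenioid.IsFrobenioid F₂) (hperf : PreFrobenioid.IsOfPerfectType F)
    (hperf₂ : PreFrobenioid.IsOfPerfectType F₂) (hpf : Objectwise (fun M _ => IsPerfFactorial M) Φ)
    (hpf₂ : Objectwise (fun M _ => IsPerfFactorial M) Φ₂) (hD : IsOfFSMType D) (hD₂ : IsOfFSMType D₂)
    (hT : Thm42Setting (ofFunctor Φ F) (ofFunctor Φ₂ F₂)) :
    ∃ e : ∀ A : C, Primes (Φ.obj (op (PreFrobenioid.baseObj F A))) ≃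
        Primes (Φ₂.obj (op (PreFrobenioid.baseObj F₂ (Ψ.functor.obj A)))),
      (∀ (A : C) (𝔭 : Primes (Φ.obj (op (PreFrobenioid.baseObj F A)))),
        (∀ ⦃B : C⦄ (φ : A ⟶ B), PreFrobenioid.IsCoAngularPreStep F φ →
            (PreFrobenioid.Div F φ ∈ 𝔭.submonoid ↔
              PreFrobenioid.Div F₂ (Ψ.functor.map φ) ∈ (e A 𝔭).submonoid)) ∧
          ∀ ⦃B : C⦄ (ψ : B ⟶ A), PreFrobenioid.IsCoAngularPreStep F ψ →
            ((∃ y ∈ 𝔭.submonoid, Frobenioids.pull Φ (PreFrobenioid.Base F ψ) y = PreFrobenioid.Div F ψ) ↔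
              ∃ y ∈ (e A 𝔭).submonoid, Frobenioids.pull Φ₂ (PreFrobenioid.Base F₂ (Ψ.functor.map ψ)) y =
                PreFrobenioid.Div F₂ (Ψ.functor.map ψ))) ∧
      (ofFunctor Φ F).Thm42iii (ofFunctor Φ₂ F₂) Ψ e := by
  have S := setting_of_isOfFSMType Ψ hF hF₂ hperf hperf₂ hpf hpf₂ hD hD₂ hT
  obtain ⟨e, he, -⟩ := PreFrobenioid.existsUnique_primesEquiv_family Ψ hF hF₂ hperf hperf₂ S.isotropic₁
    S.isotropic₂ hpf hpf₂ S.step_map S.step_inv S.preStep_map S.preStep_inv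
    (fun _ _ _ hφ => S.isPrimaryPreStep_map hφ) (fun _ _ _ hφ => S.isPrimaryPreStep_inverse_map hφ)
  exact ⟨e, he, thm42iii_of_perfectSetting Ψ S e he⟩

end PreFrobenioidData

end Literature.AlgebraicGeometry.Frobenioids
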